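import Mathlib
import Summits.QuantumFields.BalabanUV.Beta.AccretiveCombesThomasSandwich
import Summits.QuantumFields.BalabanUV.Beta.UnitLatticeWalkInversionDecay

/-!
# `Summit.QuantumFields.BalabanUV.Beta.UnitLatticeResolventWalk` — END of the x-vertex mechanism at the unit lattice:
# for `K = Q·A⁻¹·Q^*` (the sandwich of a fine-lattice inverse with `Re A⁻¹ ≥ 0` and conjugated coercivity `m`), the
# resolvent family `(1 + xK)⁻¹`, `x ∈ [0, X]` NOT small, is invertible with ONE weighted-row-sum bound and ONE walk
# expansion UNIFORMLY in `x` — the two hypotheses of `walkInversion_of_decay` (decay of `xK`, `Re`-coercivity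
# `m₀ = 1` of `1 + xK`) supplied from the sandwich (A2) by monotonicity

HONEST FRAMING (page 1 of everything in this cell).  Discharging `FlowStep.BetaPertH` would make
Bałaban's ultraviolet stability UNCONDITIONAL — a constructive-QFT result; it is NOT the continuum
limit and NOT the Clay problem.  This module discharges nothing of `BetaPertH`; [folklore] linear algebra,
kernel-checked (unit `b2b-balaban-beta-d4-p3`, road P3 «reduction road», gen 3; junction A2 → A3 of the road's re-cut of
NODE A, skeleton v1.6 §7).  It is the abstract kernel form of the owner's route A.3′ for (T2) = G-IF-10
(`OUTLINE-D4-NODE-A.md` §3: Woodbury to the unit lattice reduces «G̃₃(x) has the same properties as G̃₂» to the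
unit-lattice resolvent `(I + xK)⁻¹`, `K := Q̂G₂Q̂* ≥ 0` with exponentially decaying kernel, `x ∈ [0, 2γ₁]`), MODULO the
U-localisation bookkeeping (leaf A3-loc, typed in §7.3) and the instance (which `A = G₂`, which `Q̂`).
HONEST DEPENDENCY: continuum YM on T⁴ ⇐ BetaPertH ∧ nine spine estimates (0/9 proved); BetaPertH ⇐
(D1) ∧ (D4) ∧ CAP+tail; G-an2-4 gates asym, D1 and NE2/3/4.

CONTENTS (0 sorry).
* §1 `form_sandwich_eq`: `z^*·(sandwich A q)·z = v^* A⁻¹ v` with `v = Σ_y z_y q_y` — hence `Re z^*Kz ≥ 0` when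
  `Re v^*A⁻¹v ≥ 0` (`re_form_sandwich_nonneg`), and `1 + xK` is `Re`-coercive with `m₀ = 1` for every `x ≥ 0`
  (`reCoercive_one_add_smul_sandwich`: the MONOTONICITY «G₃(x)⁻¹ ≥ G₂⁻¹» at the unit lattice);
* §2 `norm_smul_sandwich_le`: `‖(xK)(y,y′)‖ ≤ (X·N/m)·e^{−κ₀D(y,y′)}` on `x ∈ [0, X]` (A2's `norm_sandwich_inv_le`);
* §3 END `resolventWalkInversion`: for every `x ∈ [0, X]`, `1 + xK` is invertible, equals `Ptot·(1 − Rem)⁻¹` with the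
  constructed local inverses, and `WRS κ D (1 + xK)⁻¹ ≤ N·C_L·(1 − ρ)⁻¹` with `C_L`, `ρ` INDEPENDENT of `x` (they see
  only `θ = X·N_q/m`): `UnitLatticeWalkInversionDecay.walkInversion_of_decay` BY NAME.
NOT HERE: U-localisation (A3-loc), Woodbury algebra, any instance; NOT summit progress.
-/

open scoped BigOperators Matrix ComplexConjugate
open Finset Matrix

namespace Summit.QuantumFields.BalabanUV.Beta.UnitLatticeResolventWalk

open Summit.QuantumFields.BalabanUV.Beta.AccretiveCombesThomas
open Summit.QuantumFields.BalabanUV.Beta.AccretiveCombesThomasSandwich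
open Summit.QuantumFields.BalabanUV.Beta.UnitLatticeWalkInversion
open Summit.QuantumFields.BalabanUV.Beta.UnitLatticeWalkInversionDecay
open Literature.MathematicalPhysics.QuantumFieldTheory.Balaban1983to89.B5Prop11Lower (nsq nsq_nonneg)
open Literature.MathematicalPhysics.QuantumFieldTheory.Balaban1983to89.B13PerturbativeStep (wrs WRS WeightHyp)

noncomputable section

variable {X Y : Type*} [Fintype X] [DecidableEq X] [Fintype Y] [DecidableEq Y]

/-! ## §1 The sandwich is `Re`-nonnegative when `A⁻¹` is; `1 + xK` is `Re`-coercive with `m₀ = 1` -/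

/-- The conjugated test-vector matrix `Qm(y,x) = conj(q_y(x))`, so that `sandwich A q = Qm·A⁻¹·Qmᴴ`. [folklore] -/
def Qm (q : Y → X → ℂ) : Matrix Y X ℂ := fun y x => (starRingEnd ℂ) (q y x)

/-- The superposition `v = Σ_y z_y q_y` of the block test vectors (`= Qmᴴ z`). [folklore] -/
def superpose (q : Y → X → ℂ) (z : Y → ℂ) : X → ℂ := (Qm q)ᴴ *ᵥ z

omit [Fintype Y] [DecidableEq Y] in
/-- `sandwich A q = Qm·A⁻¹·Qmᴴ`. [folklore] -/
theorem sandwich_eq_mul (A : Matrix X X ℂ) (q : Y → X → ℂ) : sandwich A q = Qm q * A⁻¹ * (Qm q)ᴴ := by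
  ext y y'
  rw [sandwich, Matrix.mul_assoc, Matrix.mul_apply, dotProduct]
  refine Finset.sum_congr rfl fun x _ => ?_
  rw [Pi.star_apply, Complex.star_def, Matrix.mul_apply, Matrix.mulVec, dotProduct]
  rw [Qm]
  congr 1
  refine Finset.sum_congr rfl fun x' _ => ?_
  simp [Matrix.conjTranspose_apply, Qm]

omit [DecidableEq Y] in
/-- **The sandwich form is a fine-lattice form**: `z^*·(sandwich A q)·z = v^* A⁻¹ v`, `v = Σ_y z_y q_y`. [folklore] -/
theorem form_sandwich_eq (A : Matrix X X ℂ) (q : Y → X → ℂ) (z : Y → ℂ) :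
    star z ⬝ᵥ (sandwich A q *ᵥ z) = star (superpose q z) ⬝ᵥ (A⁻¹ *ᵥ superpose q z) := by
  rw [sandwich_eq_mul, ← Matrix.mulVec_mulVec, ← Matrix.mulVec_mulVec, Matrix.dotProduct_mulVec, superpose,
    Matrix.star_mulVec, Matrix.conjTranspose_conjTranspose]

omit [DecidableEq Y] in
/-- `Re z^*Kz ≥ 0` for the sandwich `K` when `Re v^*A⁻¹v ≥ 0` for all `v`. [folklore] -/
theorem re_form_sandwich_nonneg (A : Matrix X X ℂ) (hA : ∀ v : X → ℂ, 0 ≤ (star v ⬝ᵥ (A⁻¹ *ᵥ v)).re)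
    (q : Y → X → ℂ) (z : Y → ℂ) : 0 ≤ (star z ⬝ᵥ (sandwich A q *ᵥ z)).re := by
  rw [form_sandwich_eq]; exact hA _

/-- **`1 + xK` is `Re`-coercive with `m₀ = 1`** for every `x ≥ 0` (monotonicity: the x-vertex is `Re`-nonnegative).
[folklore] -/
theorem reCoercive_one_add_smul_sandwich (A : Matrix X X ℂ) (hA : ∀ v : X → ℂ, 0 ≤ (star v ⬝ᵥ (A⁻¹ *ᵥ v)).re)
    (q : Y → X → ℂ) {x : ℝ} (hx : 0 ≤ x) (z : Y → ℂ) :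
    1 * nsq z ≤ (star z ⬝ᵥ ((1 + (x : ℂ) • sandwich A q) *ᵥ z)).re := by
  refine reCoercive_add_of_re_nonneg (A := (1 : Matrix Y Y ℂ)) (fun w => ?_) (fun w => ?_) z
  · rw [Matrix.one_mulVec,
      Literature.MathematicalPhysics.QuantumFieldTheory.Balaban1983to89.B5Prop11Lower.star_dotProduct_self,
      Complex.ofReal_re, one_mul]
  · rw [Matrix.smul_mulVec, dotProduct_smul, smul_eq_mul, Complex.re_ofReal_mul]
    exact mul_nonneg hx (re_form_sandwich_nonneg A hA q w)

/-! ## §2 Decay of `xK` on the compact x-range -/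

omit [Fintype Y] [DecidableEq Y] in
/-- `‖(xK)(y,y′)‖ ≤ (X·N/m)·e^{−κ₀D(y,y′)}` for `x ∈ [0, X]` (A2's `norm_sandwich_inv_le`). [folklore] -/
theorem norm_smul_sandwich_le (A : Matrix X X ℂ) (blk : X → Y) (D : Y → Y → ℝ) (hD0 : ∀ y, D y y = 0)
    (q : Y → X → ℂ) (hq : ∀ y x, blk x ≠ y → q y x = 0) {N : ℝ} (hN : ∀ y, nsq (q y) ≤ N)
    {κ₀ m X₀ x : ℝ} (hκ₀ : 0 ≤ κ₀) (hm : 0 < m)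
    (hc : ∀ y', ∀ z : X → ℂ, m * nsq z ≤ (conjForm A κ₀ (fun x => D (blk x) y') z).re)
    (hx : 0 ≤ x) (hxX : x ≤ X₀) (y y' : Y) :
    ‖((x : ℂ) • sandwich A q) y y'‖ ≤ X₀ * N / m * Real.exp (-(κ₀ * D y y')) := by
  rw [Matrix.smul_apply, smul_eq_mul, norm_mul, Complex.norm_real, Real.norm_of_nonneg hx]
  have h := norm_sandwich_inv_le A blk D hD0 q hq hN hκ₀ hm hc y y'
  have hN0 : 0 ≤ N := (nsq_nonneg _).trans (hN y)
  have hE : 0 ≤ N * (Real.exp (-(κ₀ * D y y')) / m) := mul_nonneg hN0 (div_nonneg (Real.exp_pos _).le hm.le)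
  calc x * ‖sandwich A q y y'‖ ≤ X₀ * (N * (Real.exp (-(κ₀ * D y y')) / m)) :=
        mul_le_mul hxX h (norm_nonneg _) (hx.trans hxX)
    _ = X₀ * N / m * Real.exp (-(κ₀ * D y y')) := by ring

/-! ## §3 END: the resolvent walk inversion, uniform on the compact x-range -/

/-- **THE RESOLVENT WALK INVERSION, x-UNIFORM.**  Fine-lattice kernel `A` with `Re v^*A⁻¹v ≥ 0` and conjugated
coercivity `m` along the block-constant weights at rate `κ₀`; block test vectors `q_y` (`‖q_y‖² ≤ N_q`); unit-lattice
symmetric pseudo-metric `D`, rate `κ ≤ κ₁`; partition data `(h, □̃)` at scale `M` with overlap `N`; profiles `L₁`, `L`;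
`θ := X·N_q/m`.  IF `κ₁θL₁ < 1` and `(2N/M)·(L/(1 − κ₁θL₁))·θL₁ < 1` (x-FREE conditions), THEN FOR EVERY `x ∈ [0, X]`:
`1 + x·sandwich A q` is invertible, equals `Ptot·(1 − Rem)⁻¹` with the constructed local inverses, and
`WRS κ D (1 + xK)⁻¹ ≤ N·C_L·(1 − ρ)⁻¹` with the SAME `C_L`, `ρ` for all `x`. [folklore] -/
theorem resolventWalkInversion {B : Type*} [Fintype B] (A : Matrix X X ℂ)
    (hA : ∀ v : X → ℂ, 0 ≤ (star v ⬝ᵥ (A⁻¹ *ᵥ v)).re) (blk : X → Y) (D : Y → Y → ℝ) {κ : ℝ} (hw : WeightHyp κ D)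
    (hDs : ∀ i j, D i j = D j i) (q : Y → X → ℂ) (hq : ∀ y x, blk x ≠ y → q y x = 0) {Nq : ℝ}
(hNq0 : 0 ≤ Nq) (hNq : ∀ y, nsq (q y) ≤ Nq) {κ₀ κ₁ m X₀ : ℝ} (hκ₀ : 0 ≤ κ₀) (hm : 0 < m) (hX : 0 ≤ X₀)
    (hc : ∀ y', ∀ z : X → ℂ, m * nsq z ≤ (conjForm A κ₀ (fun x => D (blk x) y') z).re)
    (h : B → Y → ℝ) (E : B → Finset Y) (hsum : ∀ y, ∑ b, h b y ^ 2 = 1) (hsupp : ∀ b y, y ∉ E b → h b y = 0)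
    (habs : ∀ b y, |h b y| ≤ 1) {M N L₁ L : ℝ} (hM : 0 < M) (hLip : ∀ b y y', |h b y - h b y'| ≤ D y y' / M)
    (hN : ∀ y, ((Finset.univ.filter fun b => y ∈ E b).card : ℝ) ≤ N) (hκκ₁ : κ ≤ κ₁)
    (hL₁ : ∀ i, ∑ j, D i j * Real.exp (-((κ₀ - κ₁) * D i j)) ≤ L₁)
    (hL : ∀ i, ∑ j, Real.exp (-((κ₁ - κ) * D i j)) ≤ L) (hL0 : 0 ≤ L)
    (hb1 : κ₁ * (X₀ * Nq / m) * L₁ < 1)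
    (hb2 : 2 * N / M * ((1 - κ₁ * (X₀ * Nq / m) * L₁)⁻¹ * L) * (X₀ * Nq / m * L₁) < 1)
    {x : ℝ} (hx : 0 ≤ x) (hxX : x ≤ X₀) :
    IsUnit (1 + (x : ℂ) • sandwich A q)
      ∧ (1 + (x : ℂ) • sandwich A q)⁻¹
          = Ptot h (locInv ((x : ℂ) • sandwich A q) E) * (1 - Rem h ((x : ℂ) • sandwich A q)
              (locInv ((x : ℂ) • sandwich A q) E))⁻¹
      ∧ WRS κ D (1 + (x : ℂ) • sandwich A q)⁻¹
          (N * ((1 - κ₁ * (X₀ * Nq / m) * L₁)⁻¹ * L)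
            * (1 - 2 * N / M * ((1 - κ₁ * (X₀ * Nq / m) * L₁)⁻¹ * L) * (X₀ * Nq / m * L₁))⁻¹) := by
  have hθ : 0 ≤ X₀ * Nq / m := div_nonneg (mul_nonneg hX hNq0) hm.le
  have hK : ∀ i j, ‖((x : ℂ) • sandwich A q) i j‖ ≤ X₀ * Nq / m * Real.exp (-(κ₀ * D i j)) :=
    fun i j => norm_smul_sandwich_le A blk D hw.zero q hq hNq hκ₀ hm hc hx hxX i j
  have hRe : ∀ z : Y → ℂ, 1 * nsq z ≤ (star z ⬝ᵥ ((1 + (x : ℂ) • sandwich A q) *ᵥ z)).re :=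
    reCoercive_one_add_smul_sandwich A hA q hx
  exact walkInversion_of_decay hw hDs ((x : ℂ) • sandwich A q) h E hsum hsupp habs hM hLip hN hθ hκκ₁ hK
    one_pos hRe hL₁ hL hL0 hb1 hb2

end

end Summit.QuantumFields.BalabanUV.Beta.UnitLatticeResolventWalk
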